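import Literature.Probability.LatticeModels.FrohlichSpencerEnsembleExpansion
import Mathlib.Combinatorics.SimpleGraph.Paths
import Mathlib.Combinatorics.SimpleGraph.Connectivity.Connected
import Mathlib.Data.Pi.Interval
import Mathlib.Data.Int.Interval
import HarnessLib

/-!
# Geometry of 1-ensembles: neighbourhood sizes, diameters of connected supports, counting
# disjoint supports near a cell (inputs of FS82 (2.45), (2.85), (2.87))

Support file for the Fröhlich–Spencer analysis of `U(1)₄` (proof programme of the named fact
`Literature.MathematicalPhysics.QuantumFieldTheory.FrohlichSpencerU1PerimeterLawD4` and of its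
corollary `Literature.Barriers.QuantumFields.AbelianDeconfinementD4`), complementing
`FrohlichSpencerEnsembleExpansion` (FS82 Lemma 2): the purely combinatorial estimates that turn
the activity bound `K(ρ) ≤ 3^{N₁(supp ρ)} ∏ z` and the connectedness of the supports into the
geometric statements used in FS82 §2.9–2.10:

* `card_nbhd_le` — if every link has at most `K` adjacent links then `N₁(A) ≤ (K + 1)·#A` (so
  `3^{N₁(supp ρ)} ≤ 3^{(K+1) L(ρ)}`, the "simple, geometric estimate on `N₁(supp ρ)`" behind
  (2.74));
* `IsAdjConnected.dist_le` — a set of links connected at distance `1` has diameter at most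
  `r₀ (#A - 1)` for any pseudo-distance `δ` with `adj a b → δ a b ≤ r₀` (so `supp ρ` lies in a cube
  of side `O(L(ρ))`: the bound `card(Ω_ρ) ≤ const L(ρ)⁴` of (2.85));
* `card_filter_subset_le` — at most `#Ball` members of a family of pairwise disjoint non-empty sets
  can lie inside a given finite set `Ball` (the counting behind (2.87): densities of size `ℓ` whose
  hull contains a given cell lie in a ball of `O(ℓ⁴)` cells, and they are disjoint);
* `card_Icc_site` — the cube `[p - r, p + r] ⊆ ℤ^d` has `(2r+1)^d` sites;
* `closed_of_sum_closed` — for a local additive operator `d` (a coboundary) and densities no two of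
  which charge faces of a common check, a closed signed sum `∑ σ_k ρ_k` has every member with
  `σ_k ≠ 0` closed (the locality argument of FS82 (2.47)).

Everything is proved; no named fact is introduced.

## References

* J. Fröhlich, T. Spencer, Comm. Math. Phys. 83 (1982) 411–454, §2.6 (2.45), §2.9 (2.74),
  §2.6 (2.47), §2.10 (2.85)–(2.87). [FrohlichSpencerCMP1982]
-/

noncomputable section

open Finset
open scoped BigOperators

namespace Literature.Probability.LatticeModels

namespace EnsembleExpansion

variable {B : Type*} [DecidableEq B]

/-! ### Neighbourhood sizes under a degree bound -/

open Classical in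
/-- **`N₁(A) ≤ (K+1) #A` under a degree bound `K`** (the geometric estimate behind FS82 (2.74)).
[cite: FrohlichSpencerCMP1982, §2.9 (2.74) p. 430] -/
theorem card_nbhd_le (adj : B → B → Prop) (S A : Finset B) (K : ℕ)
    (hdeg : ∀ a ∈ A, (S.filter fun b => adj a b).card ≤ K) :
    (nbhd adj S A).card ≤ (K + 1) * A.card := by
  have hsub : nbhd adj S A ⊆ A ∪ A.biUnion fun a => S.filter fun b => adj a b := by
    intro b hb
    rw [mem_nbhd] at hb
    rcases hb.2 with h | ⟨a, ha, hab⟩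
    · exact Finset.mem_union_left _ h
    · exact Finset.mem_union_right _ (Finset.mem_biUnion.2 ⟨a, ha, Finset.mem_filter.2 ⟨hb.1, hab⟩⟩)
  calc (nbhd adj S A).card ≤ (A ∪ A.biUnion fun a => S.filter fun b => adj a b).card :=
        Finset.card_le_card hsub
    _ ≤ A.card + (A.biUnion fun a => S.filter fun b => adj a b).card := Finset.card_union_le _ _
    _ ≤ A.card + ∑ a ∈ A, (S.filter fun b => adj a b).card := by
        gcongr; exact Finset.card_biUnion_le
    _ ≤ A.card + ∑ a ∈ A, K := by gcongr with a ha; exact hdeg a ha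
    _ = (K + 1) * A.card := by rw [Finset.sum_const, smul_eq_mul]; ring

/-! ### Diameter of connected supports -/

/-- The simple graph on `↥A` induced by (the symmetrisation of) `adj`. [folklore] -/
def adjGraph (adj : B → B → Prop) (A : Finset B) : SimpleGraph ↥A :=
  SimpleGraph.fromRel fun x y : ↥A => adj x y

/-- Paths in `A` for `adj` give walks in the induced graph. [folklore] -/
theorem reachable_of_reflTransGen {adj : B → B → Prop} {A : Finset B} {a b : B}
    (h : Relation.ReflTransGen (fun x y => x ∈ A ∧ y ∈ A ∧ adj x y) a b) (ha : a ∈ A) (hb : b ∈ A) :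
    (adjGraph adj A).Reachable ⟨a, ha⟩ ⟨b, hb⟩ := by
  induction h with
  | refl => exact SimpleGraph.Reachable.refl _
  | @tail x y _ hxy ih =>
    have hx : x ∈ A := hxy.1
    refine (ih hx).trans ?_
    by_cases hne : x = y
    · subst hne; exact SimpleGraph.Reachable.refl _
    · refine SimpleGraph.Adj.reachable ?_
      rw [adjGraph, SimpleGraph.fromRel_adj]
      exact ⟨fun h => hne (congrArg Subtype.val h), Or.inl hxy.2.2⟩

omit [DecidableEq B] in
/-- Along a walk, a pseudo-distance grows by at most `r₀` per step. [folklore] -/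
theorem dist_le_mul_length {adj : B → B → Prop} {A : Finset B} (δ : B → B → ℕ)
    (hδ0 : ∀ a, δ a a = 0) (hδt : ∀ a b c, δ a c ≤ δ a b + δ b c) (hδs : ∀ a b, δ a b = δ b a)
    (r₀ : ℕ) (hadjδ : ∀ a b, adj a b → δ a b ≤ r₀) :
    ∀ {u v : ↥A} (w : (adjGraph adj A).Walk u v), δ u v ≤ r₀ * w.length := by
  intro u v w
  induction w with
  | nil => simp [hδ0]
  | @cons u x v h w ih =>
    rw [SimpleGraph.Walk.length_cons]
    have hux : δ u x ≤ r₀ := by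
      rw [adjGraph, SimpleGraph.fromRel_adj] at h
      rcases h.2 with h | h
      · exact hadjδ _ _ h
      · rw [hδs]; exact hadjδ _ _ h
    calc δ u v ≤ δ u x + δ x v := hδt _ _ _
      _ ≤ r₀ + r₀ * w.length := add_le_add hux ih
      _ = r₀ * (w.length + 1) := by ring

/-- **Connected supports have diameter `≤ r₀ (#A - 1)`** for any pseudo-distance `δ` (zero on the
diagonal, symmetric, triangle inequality) with `adj a b → δ a b ≤ r₀`: a shortest path has
distinct vertices. (FS82 (2.85): `supp ρ` lies in a hypercube `Ω_ρ` of side `O(L(ρ))`.)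
[cite: FrohlichSpencerCMP1982, §2.10 (2.85) p. 432] -/
theorem IsAdjConnected.dist_le {adj : B → B → Prop} {A : Finset B} (hA : IsAdjConnected adj A)
    (δ : B → B → ℕ) (hδ0 : ∀ a, δ a a = 0) (hδt : ∀ a b c, δ a c ≤ δ a b + δ b c)
    (hδs : ∀ a b, δ a b = δ b a) (r₀ : ℕ) (hadjδ : ∀ a b, adj a b → δ a b ≤ r₀)
    {a b : B} (ha : a ∈ A) (hb : b ∈ A) : δ a b ≤ r₀ * (A.card - 1) := by
  classical
  obtain ⟨w⟩ := reachable_of_reflTransGen (hA a ha b hb) ha hb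
  have hpath := w.bypass_isPath
  have hlen : w.bypass.length < A.card := by
    have := hpath.length_lt
    rwa [Fintype.card_coe] at this
  calc δ a b ≤ r₀ * w.bypass.length := dist_le_mul_length δ hδ0 hδt hδs r₀ hadjδ w.bypass
    _ ≤ r₀ * (A.card - 1) := Nat.mul_le_mul_left _ (by omega)

/-! ### Counting disjoint supports inside a ball -/

/-- **At most `#Ball` members of a family of pairwise disjoint non-empty sets lie inside `Ball`.**
(FS82 (2.87): the densities of a 1-ensemble have disjoint supports.) [cite: FrohlichSpencerCMP1982, §2.10 (2.87) p. 432] -/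
theorem card_filter_subset_le {D : Type*} {P : Type*} [DecidableEq P] (N : Finset D)
    (supp : D → Finset P) (hdisj : (N : Set D).PairwiseDisjoint supp)
    (hne : ∀ ρ ∈ N, (supp ρ).Nonempty) (Ball : Finset P) (Q : D → Prop) [DecidablePred Q]
    (hQ : ∀ ρ ∈ N, Q ρ → supp ρ ⊆ Ball) :
    (N.filter Q).card ≤ Ball.card := by
  have hdisj' : ((N.filter Q : Finset D) : Set D).PairwiseDisjoint supp :=
    hdisj.subset (by intro ρ hρ; exact (Finset.mem_filter.1 hρ).1)
  calc (N.filter Q).card ≤ ((N.filter Q).biUnion supp).card :=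
        Finset.card_le_card_biUnion hdisj' fun ρ hρ => hne ρ (Finset.mem_filter.1 hρ).1
    _ ≤ Ball.card := Finset.card_le_card (Finset.biUnion_subset.2 fun ρ hρ =>
        hQ ρ (Finset.mem_filter.1 hρ).1 (Finset.mem_filter.1 hρ).2)

/-! ### Balls in `ℤ^d` -/

/-- The cube `[p - r, p + r] ⊆ ℤ^d` has `(2r + 1)^d` sites. [folklore] -/
theorem card_Icc_site {d : ℕ} (p : Fin d → ℤ) (r : ℕ) :
    (Finset.Icc (p - fun _ => (r : ℤ)) (p + fun _ => (r : ℤ))).card = (2 * r + 1) ^ d := by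
  rw [Pi.card_Icc]
  simp only [Pi.sub_apply, Pi.add_apply, Int.card_Icc]
  have h : ∀ x, (p x + (r : ℤ) + 1 - (p x - (r : ℤ))).toNat = 2 * r + 1 := fun x => by omega
  simp only [h, Finset.prod_const, Finset.card_univ, Fintype.card_fin]

/-- Sites at sup-distance `≤ r` from `p` lie in the cube `[p - r, p + r]`. [folklore] -/
theorem mem_Icc_site_of_forall_abs_le {d : ℕ} {p y : Fin d → ℤ} {r : ℕ}
    (h : ∀ i, |y i - p i| ≤ r) :
    y ∈ Finset.Icc (p - fun _ => (r : ℤ)) (p + fun _ => (r : ℤ)) := by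
  rw [Finset.mem_Icc]
  constructor <;> intro i <;> simp only [Pi.sub_apply, Pi.add_apply] <;> have := abs_le.1 (h i) <;> omega

/-! ### Separated supports: a closed signed sum has closed members (FS82 (2.47)) -/

/-- **Memberwise closedness from separation** (the locality argument behind FS82 (2.47): "since
any two current densities `ρ₁, ρ₂` in some `𝒩_γ` satisfy `dist(ρ₁, ρ₂) ≥ √2`, … unless `δρ = 0` for
all `ρ ∈ ℰ`"). Let `d` be an additive operator from functions on `cells` to functions on `checks`
which is LOCAL (`(d f)(C)` vanishes when `f` vanishes on the faces of `C`), and `ρ_k` densities no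
two of which charge faces of a common check. If the signed sum `∑_k σ_k ρ_k` is closed then every
`ρ_k` with `σ_k ≠ 0` is closed. [cite: FrohlichSpencerCMP1982, §2.6 Remark 1, (2.47) p. 426] -/
theorem closed_of_sum_closed {cells checks κ : Type*} [Fintype κ] (faces : checks → Finset cells)
    (d : (cells → ℤ) →+ (checks → ℤ)) (hlocal : ∀ f C, (∀ c ∈ faces C, f c = 0) → d f C = 0)
    (ρ : κ → cells → ℤ) (σ : κ → ℤ)
    (hsep : ∀ k k', k ≠ k' → ∀ C, ∀ c ∈ faces C, ρ k c ≠ 0 → ∀ c' ∈ faces C, ρ k' c' = 0)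
    (hsum : d (∑ k, σ k • ρ k) = 0) {k : κ} (hk : σ k ≠ 0) : d (ρ k) = 0 := by
  funext C
  by_cases hC : ∀ c ∈ faces C, ρ k c = 0
  · exact hlocal _ C hC
  · push Not at hC
    obtain ⟨c, hc, hρc⟩ := hC
    have hothers : ∀ k' ≠ k, d (ρ k') C = 0 := fun k' hk' =>
      hlocal _ C fun c' hc' => hsep k k' (Ne.symm hk') C c hc hρc c' hc'
    have hC' : d (∑ k', σ k' • ρ k') C = σ k * d (ρ k) C := by
      rw [map_sum, Finset.sum_apply, Finset.sum_eq_single k]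
      · rw [map_zsmul, Pi.smul_apply, smul_eq_mul]
      · intro k' _ hk'
        rw [map_zsmul, Pi.smul_apply, smul_eq_mul, hothers k' hk', mul_zero]
      · intro h; exact absurd (Finset.mem_univ k) h
    have h0 : σ k * d (ρ k) C = 0 := by rw [← hC', hsum]; rfl
    rcases mul_eq_zero.1 h0 with h | h
    · exact absurd h hk
    · exact h

/-- The separation hypothesis of `closed_of_sum_closed` from the 1-ensemble property: supports
pairwise non-adjacent for "charge faces of a common check". [cite: FrohlichSpencerCMP1982, §2.6 (2.47)] -/
theorem sep_of_pairwise_not_adj {cells checks κ : Type*} (faces : checks → Finset cells)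
    (ρ : κ → cells → ℤ)
    (hN : ∀ k k', k ≠ k' → ∀ c, ρ k c ≠ 0 → ∀ c', ρ k' c' ≠ 0 →
      ¬ ∃ C, c ∈ faces C ∧ c' ∈ faces C) :
    ∀ k k', k ≠ k' → ∀ C, ∀ c ∈ faces C, ρ k c ≠ 0 → ∀ c' ∈ faces C, ρ k' c' = 0 := by
  intro k k' hkk' C c hc hρ c' hc'
  by_contra hρ'
  exact hN k k' hkk' c hρ c' hρ' ⟨C, hc, hc'⟩

end EnsembleExpansion

end Literature.Probability.LatticeModels
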